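import Summits.QuantumAdvantage.AdviceFreeQNC0.LiftFromTransversal
import Summits.QuantumAdvantage.AdviceFreeQNC0.LiftOneUBookkeeping
import HarnessLib

/-!
# Cell qa-qnc0 (rung F-S1, route RingFrame, crux α, line `tensor`): LOC ⟹ R1U —
# `locLiftOneU : LocLiftOneU` (qn-p2 ROUND-5 §3.1 support, Sketch5 verbatim)

Planner qa-qnc0-p2's CONJECTURE LOC (`LOC`, Sketch5 §3.1 verbatim): up to the unique-decoding radius,
every system `(X, Y)` (`X` with linear columns, `Y` with rows in `RM(d, L')`, row distance `≤ w`) has a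
LOCAL CORE — `k ≤ c·(d+2)` parity conditions `⟨ℓ_i, u⟩ = 0` on the row index cutting out a subgroup
`U₀` all of whose rows agree, off ONE set `Z` of `≤ C·w` columns, with degree-`d` words.  The support
statement `LocLiftOneU : LOC → LiftOneU` (R1U with `K = (C + c)/2 + 1`) is PROVED here
(`locLiftOneU`):

* the conditions define an `𝔽₂`-linear map `φ : 𝔽₂^L → 𝔽₂^k` (`condMap`; `dotB a u ⇔ ⟨a, u⟩ = 1`,
  `dotB_eq_true_iff`); a basis of its range (`≤ k` vectors) pulled back to rows `b_j`
  (`exists_core_decomposition`): every `u` is `u₀ ⊕ Σ_j c_j b_j` with `u₀ ∈ U₀ = ker φ`;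
* rows are `𝔽₂`-combinations of basis rows (`LiftFromTransversal.indB_row_eq_sum`), so
  `X(u,·) = X(u₀,·) + Σ_j c_j X(b_j,·)`; `X(u₀,·)` is a degree-`d` word plus a `Z`-supported word
  (LOC), `X(b_j,·)` is `Y(b_j,·)` plus its leader (`≤ w` points, `MeanLoad.rowDist_eq_card_ldr`);
  hence every row has a representative of its coset mod `RM(d, L')` supported on the TRANSVERSAL
  `Z' = Z ∪ ⋃_j leader(b_j)`, `#Z' ≤ (C + c(d+2))·w`;
* the literature seat's `exists_lift_of_transversal_real` (`LiftFromTransversal.lean`) turns the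
  transversal into a lift with linear columns at cost `≤ #Z'·2^L/2 ≤ ((C+c)/2 + 1)·(d+2)·w·2^L`.

The cell's theorem (planner qa-qnc0-p2 gen 5 ROUND-5 §3.1; prover qa-qnc0-prover gen 6, 2026-08-27).
WHAT THIS IS NOT: LOC itself is a CONJECTURE (open; not claimed); nothing on `LiftOneU` unconditionally,
on `TRPlus`, α or the separation.
-/

noncomputable section

namespace Summit.QuantumAdvantage.AdviceFreeQNC0

open Finset Module
open Literature.Computability.MetaComplexity Literature.Computability.MetaComplexity.Smolensky
open MeanLoad LiftFromTransversal

/-! ### Sketch5 §3.1: the statements, verbatim -/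

/-- `⟨a,u⟩ = 1` over `𝔽₂` (qn-p2 Sketch5 §3, verbatim). -/
def dotB {L : ℕ} (a u : Fin L → Bool) : Bool :=
  decide ((univ.filter fun i : Fin L => a i = true ∧ u i = true).card % 2 = 1)

/-- **CONJECTURE LOC** (ROUND-5 §3.1, local core of bounded codimension; qn-p2 Sketch5 verbatim): every
system up to the unique-decoding radius has a subsystem of codimension `≤ c(d+2)` (cut out by `k` linear
conditions on the row index) all of whose rows are congruent mod `RM(d,L')` to rows supported on ONE set
`Z` of `≤ C·w` columns.  OPEN. -/
def LOC : Prop :=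
  ∃ c C : ℕ, ∀ L L' d w : ℕ, 2 * w ≤ 2 ^ (L' - d) →
    ∀ X Y : BMat L L', LinCols X → RowsDeg d Y → (∀ u, rowDist X Y u ≤ w) →
      ∃ k : ℕ, k ≤ c * (d + 2) ∧ ∃ ℓ : Fin k → (Fin L → Bool), ∃ Z : Finset (Fin L' → Bool),
        Z.card ≤ C * w ∧
        ∀ u, (∀ i, dotB (ℓ i) u = false) →
          ∃ p : (Fin L' → Bool) → Bool, HasDeg p d ∧ ∀ v, v ∉ Z → X u v = p v

/-- support: LOC ⇒ R1U with `K = (C + c)/2 + 1` (qn-p2 Sketch5 §3, verbatim). -/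
def LocLiftOneU : Prop := LOC → LiftOneU

namespace LocLift

variable {L L' : ℕ}

/-! ### Row indices as `𝔽₂`-vectors; the condition map -/

/-- a Boolean vector as an `𝔽₂`-vector. -/
def toZ (u : Fin L → Bool) : Fin L → ZMod 2 := fun i => if u i = true then 1 else 0

/-- an `𝔽₂`-vector as a Boolean vector. -/
def toB (x : Fin L → ZMod 2) : Fin L → Bool := fun i => decide (x i = 1)

/-- `toZ ∘ toB = id`. -/
theorem toZ_toB (x : Fin L → ZMod 2) : toZ (toB x) = x := by
  funext i
  exact zmod2_ind_decide (x i)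

/-- the condition map `u ↦ (⟨ℓ_i, u⟩)_i` as an `𝔽₂`-linear map. -/
def condMap {k : ℕ} (ℓ : Fin k → (Fin L → Bool)) : (Fin L → ZMod 2) →ₗ[ZMod 2] (Fin k → ZMod 2) where
  toFun x i := ∑ j, toZ (ℓ i) j * x j
  map_add' x y := by
    funext i
    simp only [Pi.add_apply, mul_add, Finset.sum_add_distrib]
  map_smul' c x := by
    funext i
    simp only [Pi.smul_apply, smul_eq_mul, RingHom.id_apply, Finset.mul_sum]
    exact Finset.sum_congr rfl fun j _ => by ring

/-- `dotB a u = true ⇔ Σ_j a_j u_j = 1` in `𝔽₂`. -/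
theorem dotB_eq_true_iff (a u : Fin L → Bool) :
    dotB a u = true ↔ ∑ j, toZ a j * toZ u j = 1 := by
  have hsum : ∑ j, toZ a j * toZ u j =
      ((univ.filter fun i : Fin L => a i = true ∧ u i = true).card : ZMod 2) := by
    rw [Finset.card_filter, Nat.cast_sum]
    refine Finset.sum_congr rfl fun j _ => ?_
    unfold toZ
    cases a j <;> cases u j <;> simp
  rw [hsum, ZMod.natCast_eq_one_iff_odd, Nat.odd_iff]
  unfold dotB
  rw [decide_eq_true_eq]

/-- The condition `dotB (ℓ i) (toB x) = false` is `condMap ℓ x i = 0`. -/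
theorem dotB_toB_eq_false_iff {k : ℕ} (ℓ : Fin k → (Fin L → Bool)) (x : Fin L → ZMod 2) (i : Fin k) :
    dotB (ℓ i) (toB x) = false ↔ condMap ℓ x i = 0 := by
  have key : dotB (ℓ i) (toB x) = true ↔ condMap ℓ x i = 1 := by
    rw [dotB_eq_true_iff, toZ_toB]
    exact Iff.rfl
  have h01 : ∀ z : ZMod 2, z = 0 ↔ ¬ z = 1 := by decide
  rw [h01, ← key]
  cases dotB (ℓ i) (toB x) <;> simp

/-! ### The core decomposition `u = u₀ ⊕ Σ c_j b_j` -/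

/-- **Complement representatives of the local core**: there are `k' ≤ k` row indices `b_j` such that
every `x ∈ 𝔽₂^L` is `x₀ + Σ_j c_j b_j` with `x₀` in the kernel of the condition map. -/
theorem exists_core_decomposition {k : ℕ} (ℓ : Fin k → (Fin L → Bool)) :
    ∃ k' : ℕ, k' ≤ k ∧ ∃ b : Fin k' → (Fin L → ZMod 2), ∀ x : Fin L → ZMod 2,
      ∃ c : Fin k' → ZMod 2, condMap ℓ (x + ∑ j, c j • b j) = 0 := by
  set R := LinearMap.range (condMap ℓ) with hR
  set B := Module.finBasis (ZMod 2) R with hB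
  refine ⟨finrank (ZMod 2) R, ?_, ?_⟩
  · calc finrank (ZMod 2) R ≤ finrank (ZMod 2) (Fin k → ZMod 2) := Submodule.finrank_le R
      _ = k := by rw [Module.finrank_fintype_fun_eq_card, Fintype.card_fin]
  · have hpre : ∀ j, ∃ y : Fin L → ZMod 2, condMap ℓ y = (B j : Fin k → ZMod 2) := fun j =>
      LinearMap.mem_range.1 (B j).2
    choose b hb using hpre
    refine ⟨b, fun x => ?_⟩
    set s : R := ⟨condMap ℓ x, LinearMap.mem_range_self _ x⟩ with hs
    refine ⟨fun j => B.repr s j, ?_⟩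
    have hsum : ∑ j, B.repr s j • (B j : Fin k → ZMod 2) = condMap ℓ x := by
      have h := B.sum_repr s
      have h' := congrArg (fun t : R => (t : Fin k → ZMod 2)) h
      simp only [Submodule.coe_sum, Submodule.coe_smul] at h'
      exact h'
    rw [map_add, map_sum]
    simp only [map_smul, hb]
    rw [hsum]
    funext i
    simp only [Pi.add_apply, Pi.zero_apply, CharTwo.add_self_eq_zero]

/-! ### Rows as a linear function of the index -/

/-- the row map `x ↦ Σ_i x_i · X(e_i, ·)` (linear; equals `X(u,·)` at `x = toZ u` when the columns of
`X` are linear). -/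
def rowLin (X : BMat L L') : (Fin L → ZMod 2) →ₗ[ZMod 2] CubeFn (ZMod 2) L' where
  toFun x := ∑ i, x i • indB (X (basisRow i))
  map_add' x y := by
    simp only [Pi.add_apply, add_smul, Finset.sum_add_distrib]
  map_smul' c x := by
    simp only [Pi.smul_apply, smul_eq_mul, RingHom.id_apply, Finset.smul_sum, smul_smul]

/-- `rowLin X (toZ u) = X(u,·)` for linear columns. -/
theorem rowLin_toZ {X : BMat L L'} (hX : LinCols X) (u : Fin L → Bool) :
    rowLin X (toZ u) = indB (X u) := by
  rw [indB_row_eq_sum hX u]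
  rfl

/-- A row splits as `Y`-row plus leader: `X(u,·) = Y(u,·) + ldr(u,·)` in `𝔽₂`. -/
theorem indB_row_eq_add_ldr (X Y : BMat L L') (u : Fin L → Bool) :
    indB (X u) = indB (Y u) + indB (ldr X Y u) := by
  funext v
  have hx : X u v = xor (Y u v) (ldr X Y u v) := by
    unfold ldr
    cases X u v <;> cases Y u v <;> rfl
  rw [Pi.add_apply, indB_apply, indB_apply, indB_apply, hx, ind_xor]

end LocLift

/-! ### LOC ⟹ R1U -/

open LocLift in
/-- **`locLiftOneU : LocLiftOneU`** — CONJECTURE LOC implies R1U (`LiftOneU`) with `K = (C + c)/2 + 1`. -/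
theorem locLiftOneU : LocLiftOneU := by
  rintro ⟨c, C, hLOC⟩
  refine ⟨((C : ℝ) + c) / 2 + 1, by positivity, ?_⟩
  intro L L' d w hw X Y hX hY hdist
  obtain ⟨k, hk, ℓ, Z, hZ, hcore⟩ := hLOC L L' d w hw X Y hX hY hdist
  obtain ⟨k', hk', b, hdec⟩ := exists_core_decomposition ℓ
  -- the transversal: `Z ∪ ⋃_j leader(b_j)`
  set A : Fin k' → Finset (Fin L' → Bool) := fun j =>
    univ.filter fun v : Fin L' → Bool => ldr X Y (toB (b j)) v = true with hA
  set Z' : Finset (Fin L' → Bool) := Z ∪ univ.biUnion A with hZ'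
  have hA_card : ∀ j, (A j).card ≤ w := fun j => by
    rw [hA, ← rowDist_eq_card_ldr]; exact hdist _
  have hZ'_card : Z'.card ≤ (C + c * (d + 2)) * w := by
    calc Z'.card ≤ Z.card + (univ.biUnion A).card := Finset.card_union_le _ _
      _ ≤ C * w + ∑ j, (A j).card := add_le_add hZ Finset.card_biUnion_le
      _ ≤ C * w + ∑ _j : Fin k', w := by
          refine add_le_add le_rfl (Finset.sum_le_sum fun j _ => hA_card j)
      _ = C * w + k' * w := by rw [Finset.sum_const, Finset.card_univ, Fintype.card_fin, smul_eq_mul]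
      _ ≤ (C + c * (d + 2)) * w := by nlinarith
  -- every row has a `Z'`-supported representative
  have H : ∀ u, ∃ v : (Fin L' → Bool) → Bool, (∀ p, v p = true → p ∈ Z') ∧
      HasDeg (fun p => xor (X u p) (v p)) d := by
    intro u
    obtain ⟨cj, hx₀⟩ := hdec (toZ u)
    set x₀ : Fin L → ZMod 2 := toZ u + ∑ j, cj j • b j with hx₀def
    -- the core row `u₀`
    have hu₀ : ∀ i, dotB (ℓ i) (toB x₀) = false := fun i => by
      rw [dotB_toB_eq_false_iff, hx₀]; rfl
    obtain ⟨p, hp, hpZ⟩ := hcore (toB x₀) hu₀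
    -- the `Z`-supported remainder of the core row and the representative `r`
    set r₀ : CubeFn (ZMod 2) L' := indB (X (toB x₀)) + indB p with hr₀
    set r : CubeFn (ZMod 2) L' := r₀ + ∑ j, cj j • indB (ldr X Y (toB (b j))) with hr
    have hr₀Z : ∀ v, v ∉ Z → r₀ v = 0 := fun v hv => by
      rw [hr₀, Pi.add_apply, indB_apply, indB_apply, hpZ v hv]
      cases p v <;> decide
    have hrZ : ∀ v, v ∉ Z' → r v = 0 := by
      intro v hv
      rw [hZ', Finset.mem_union, not_or, Finset.mem_biUnion] at hv
      rw [hr, Pi.add_apply, hr₀Z v hv.1, zero_add, Finset.sum_apply]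
      refine Finset.sum_eq_zero fun j _ => ?_
      have hvj : ldr X Y (toB (b j)) v = false := by
        by_contra h
        exact hv.2 ⟨j, Finset.mem_univ _, by rw [hA, Finset.mem_filter]; exact ⟨Finset.mem_univ _, by
          cases h' : ldr X Y (toB (b j)) v
          · exact absurd h' h
          · rfl⟩⟩
      rw [Pi.smul_apply, indB_apply, hvj]
      simp
    -- the row decomposition `X(u,·) = q + r`, `q` of degree `≤ d`
    have hrow : indB (X u) = (indB p + ∑ j, cj j • indB (Y (toB (b j)))) + r := by
      have h1 : indB (X u) = rowLin X (toZ u) := (rowLin_toZ hX u).symm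
      have h2 : toZ u = x₀ + ∑ j, cj j • b j := by
        rw [hx₀def, add_assoc]
        have : (∑ j, cj j • b j) + ∑ j, cj j • b j = 0 := by
          funext i; simp only [Pi.add_apply, Pi.zero_apply, CharTwo.add_self_eq_zero]
        rw [this, add_zero]
      rw [h1, h2, map_add, map_sum]
      simp only [map_smul]
      rw [← toZ_toB x₀, rowLin_toZ hX]
      have h3 : ∀ j, rowLin X (b j) = indB (Y (toB (b j))) + indB (ldr X Y (toB (b j))) := fun j => by
        rw [← toZ_toB (b j), rowLin_toZ hX, toZ_toB, indB_row_eq_add_ldr X Y]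
      simp only [h3, smul_add, Finset.sum_add_distrib]
      rw [hr, hr₀]
      have hpp : indB p + indB p = 0 := by
        funext v; simp only [Pi.add_apply, Pi.zero_apply, CharTwo.add_self_eq_zero]
      have key : ∀ A P S₁ S₂ : CubeFn (ZMod 2) L', P + P = 0 →
          A + (S₁ + S₂) = (P + S₁) + ((A + P) + S₂) := by
        intro A P S₁ S₂ h
        have e : (P + S₁) + ((A + P) + S₂) = A + (S₁ + S₂) + (P + P) := by abel
        rw [e, h, add_zero]
      exact key _ _ _ _ hpp
    refine ⟨fun p' => decide (r p' = 1), fun p' hp' => ?_, ?_⟩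
    · by_contra hZ
      have h := hrZ p' hZ
      have hp'' : decide (r p' = 1) = true := hp'
      rw [h] at hp''
      exact absurd hp'' (by decide)
    · show (fun p' => if xor (X u p') (decide (r p' = 1)) = true then (1 : ZMod 2) else 0) ∈
        lowDeg (ZMod 2) L' d
      have h : (fun p' => if xor (X u p') (decide (r p' = 1)) = true then (1 : ZMod 2) else 0) =
          indB (X u) + r := by
        funext p'
        rw [ind_xor, zmod2_ind_decide, Pi.add_apply, indB_apply]
      rw [h, hrow, add_assoc]
      have hrr : r + r = 0 := by
        funext v; simp only [Pi.add_apply, Pi.zero_apply, CharTwo.add_self_eq_zero]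
      rw [hrr, add_zero]
      refine Submodule.add_mem _ hp (Submodule.sum_mem _ fun j _ => Submodule.smul_mem _ _ (hY _))
  -- the lift
  obtain ⟨W, hW, hWd, hcost⟩ := exists_lift_of_transversal_real Z' hX H
  refine ⟨W, hW, hWd, hcost.trans ?_⟩
  have hZR : (Z'.card : ℝ) ≤ ((C : ℝ) + c * (d + 2)) * w := by exact_mod_cast hZ'_card
  have hpos : (0 : ℝ) ≤ (w : ℝ) * (2 : ℝ) ^ L := by positivity
  have hd : (0 : ℝ) ≤ (d : ℝ) := by positivity
  have hc0 : (0 : ℝ) ≤ (c : ℝ) := by positivity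
  have hC0 : (0 : ℝ) ≤ (C : ℝ) := by positivity
  calc (Z'.card : ℝ) * (2 : ℝ) ^ L / 2 ≤ ((C : ℝ) + c * (d + 2)) * w * (2 : ℝ) ^ L / 2 := by
        gcongr
    _ ≤ (((C : ℝ) + c) / 2 + 1) * (d + 2) * w * (2 : ℝ) ^ L := by
        have h1 : ((C : ℝ) + c * (d + 2)) / 2 ≤ (((C : ℝ) + c) / 2 + 1) * (d + 2) := by nlinarith
        calc ((C : ℝ) + c * (d + 2)) * w * (2 : ℝ) ^ L / 2
            = (((C : ℝ) + c * (d + 2)) / 2) * (w * (2 : ℝ) ^ L) := by ring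
          _ ≤ ((((C : ℝ) + c) / 2 + 1) * (d + 2)) * (w * (2 : ℝ) ^ L) :=
              mul_le_mul_of_nonneg_right h1 hpos
          _ = (((C : ℝ) + c) / 2 + 1) * (d + 2) * w * (2 : ℝ) ^ L := by ring

end Summit.QuantumAdvantage.AdviceFreeQNC0

end
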